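import Mathlib
import HarnessLib
import HarnessLib.Audit
import Summits.NavierStokesRegularity.Statement
import Literature.Analysis.FluidPDE.ClassicalSolution
import Literature.Analysis.FluidPDE.LerayHopf
import Literature.Analysis.FluidPDE.NSWave0
import Literature.Analysis.FluidPDE.VectorCalculus
import Literature.Analysis.FluidPDE.SuitableWeak
import Literature.Analysis.FluidPDE.LocalTypeI
import Literature.Analysis.FluidPDE.NSCriticalClosureBesovKatoClass
import Summits.NavierStokesRegularity.NavierStokesRegularity.Theorems.NoBlowupToClay
import HarnessLib.Audit.Status.Attr

/-!
Route: QuarterBudgetTrace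

# Route QuarterBudgetTrace — quarter-enstrophy budget makes terminal-trace dust finite — EQL ∧
NoTraceConcentration decide Clay (A)

It suffices to show X = X1 ∧ X2 with X1 = EnstrophyQuarterLaw (the eI-shelf statement
stmt-NavierStokesRegularity-1574,
shared verbatim: a finite-energy first blow-up carries enstrophy at most K(T−t)^(−1/2)) and X2 =
NoTraceConcentration
(TerminalTrace crux B, stmt-NavierStokesRegularity-18381, shared verbatim: the final value u(T) has
vanishing scaled energy
r⁻¹∫_(B(x₀,r))|u(T)|² → 0 at every point). Lens wuc: both parts are consequences of S (no blow-up ⇒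
both premises are
vacuous / u(T) smooth), and they are USED toward S through two provable-now supports: a blow-up
obeying X1 with an
energy-flat terminal trace (X2) at a singular vertex zooms to a BUDGETED extinct Type-I apex
(BudgetedExtinctApex), and no
budgeted extinct Type-I apex is singular (NoBudgetedExtinctApex: the slab enstrophy budget
∫_(−r²,0)×ℝ³ ‖∇U‖² ≤ K′r is a
summable control, so the class-uniform depth enstrophy floor packs only finitely many apex-time
singular points, whereas
quiet-shell exclusion makes that set perfect and uncountable). No summit is proved by this line; it
files a closer.
Lean: `(∀ (ν T : ℝ), 0 < ν → 0 < T → ∀ (u : ℝ → EuclideanSpace ℝ (Fin 3) → EuclideanSpace ℝ (Fin 3))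
(p : ℝ → EuclideanSpace ℝ (Fin 3) → ℝ), Literature.Analysis.FluidPDE.IsMaximalSmoothSolution ν 0 u p
T → Literature.Analysis.FluidPDE.IsLerayHopfOn T ν 0 (u 0) u →
Literature.Analysis.FluidPDE.HasRapidSpatialDecay (u 0) → ∃ K : ℝ, ∀ t ∈ Set.Ico 0 T, ∫⁻ x,
‖Literature.Analysis.FluidPDE.curl (u t) x‖ₑ ^ 2 ≤ ENNReal.ofReal (K / Real.sqrt (T - t))) ∧ (∀ (ν T
: ℝ), 0 < ν → 0 < T → ∀ (u : ℝ → EuclideanSpace ℝ (Fin 3) → EuclideanSpace ℝ (Fin 3)) (p : ℝ →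
EuclideanSpace ℝ (Fin 3) → ℝ), Literature.Analysis.FluidPDE.IsClassicalNSSolutionOn (Set.Ico 0 T) ν
0 u p → Literature.Analysis.FluidPDE.IsLerayHopfOn T ν 0 (u 0) u →
Literature.Analysis.FluidPDE.HasRapidSpatialDecay (u 0) → ∀ x₀ : EuclideanSpace ℝ (Fin 3),
Filter.Tendsto (fun r : ℝ => r⁻¹ * ∫ x in Metric.ball x₀ r, ‖u T x‖ ^ 2) (nhdsWithin 0 (Set.Ioi 0))
(nhds 0))`

## Assembly
Pure logic over the frame theorem `Theorems.navierStokesRegularity_of_noBlowup` (NoBlowup → Clay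
(A), proved): given a classical Leray–Hopf solution on [0,T) with no smooth extension, X1 gives the
budget constant K, `exists_singularPoint_of_classical_of_not_hasSmoothExtensionPast` (ε-regularity
contrapositive, Literature) gives a singular vertex x₀, X2 gives FE(x₀), BudgetedExtinctApex
produces the budgeted extinct apex and NoBudgetedExtinctApex refutes its singularity. The deciding
theorem `closes` in glue.lean is kernel-checked (Sketch.lean rc 0, 0 sorry).

Rationale: WHY THIS LINE. Mechanism: the quarter law is a SUMMABLE, scale-invariant space-time control
(∫_(T−r²)^T ‖∇u‖₂² ≤ 2Kr, equivalently u ∈ L^(4,∞)_t L⁶_x by Sobolev), inherited by every blow-up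
zoom; in the extinct Type-I apex class H of the terminal-trace programme (nsreg-p2 ROUND-26: the
open LOUD core of stmt-18385 is Morrey-class dust, and "counts exist only for summable classes whose
proofs use quasi-additivity over disjoint balls that the Morrey norm lacks") the budget is
quasi-additive over disjoint balls, so the landed class-uniform depth floor
`stub_centreEnstrophyAtDepth` (p593596) at N separated apex-time singular points costs N·κ₀c₂√T₁
against a budget ≍ K′√T₁ at every scale T₁: N ≤ N*(K′,M,D₀,C), while
`not_countable_topSingularSet_of_quietShellExclusion` + `no_quietShellExtinctApex` (Tao–Carleman
quiet-shell exclusion, landed) make the apex-time singular set uncountable — LOUD ∩ BUDGET = ∅.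
Printed analogues of the count: WangZhang2012 Thm 5.3 (finitely many singular points in the weak
Serrin class L^(q,∞)_t L^p_x, 3<p<∞ — EQL puts u in (p,q)=(6,4)), Seregin2001, ChoeWolfYang2019,
Barker2021 (L^(3,∞)); printed regularity in that class "remains unknown except p=3" (WangZhang2012
p.3), and the terminal trace X2 is what supplies extinction of the apex (AlbrittonBarker2019,
SereginSverak2002) so that finiteness becomes absence. Imported areas: ε-regularity/blow-up
compactness (CKN1982, EscauriazaSereginSverak2003), packing, Carleman unique continuation. What no
listed route does: every eI-shelf route (StretchingWellBinding, LerayQuarterDissipation,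
CalmSliceGate, QuarterLogPincer, TypeIQuarterGaldi, HalfHolderEnergy) closes through a Liouville
residual (NoLocalTypeISingularity 10480 / FirstTimeDissipativeLiouville 22144 /
ParabolicGaldiLiouville 0893); TerminalTrace files no rate split by design and its XL crux A
(TraceDensityCriterion 18614) is rate-free; this line joins the two programmes — the shelf rate pays
for crux A in the budgeted class, and the residual is the existing one-slice trace crux 18381, not a
Liouville theorem. Negatives index (5 entries: OddMorawetzLocal, FiniteTangentModuli, PerpetualPump
thesis, CorrectorSolvable, ClayNonuniqueness) is untouched. DISTANCE LABEL (idea-crit-8 VERDICT V20,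
price P1, verbatim): Clay ⇐ EQL ∧ NTC with BOTH cruxes open-XL and each a consequence of S; the
route's DELIVERABLE is the conditional theorem S1∘S2 «a quarter-law (hence Type-I, budgeted) first
blow-up leaves a positive scaled-energy scar at some point of u(T)» = ¬(EQL-blow-up ∧ FE everywhere)
— advertised as that, never as progress on either crux; zero prover width on EQL/NTC from this route
(EQL = shelf programme via window_average/sparse_sieve; NTC = TerminalTrace).

RANKED CRUXES. #2 EnstrophyQuarterLaw (crux) — shelf statement stmt-NavierStokesRegularity-1574
verbatim (eI quarter law): a finite-energy classical solution from a rapidly decaying datum, maximal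
at T, has ∫‖curl u(t)‖² ≤ K(T−t)^(−1/2) on [0,T). [difficulty: open-problem] (why it might fail:
says every finite-energy blow-up is Type I in enstrophy (Leray's lower rate is sharp); no upper
bound on any NS blow-up rate is known, and with Seregin2020 (axisymmetric singular points are Type
II) one singular axisymmetric flow (Hou2022 numerics) kills it.) [Leray1934, Seregin2020,
Hou2022PotentiallySingularNS, Tao2021QuantitativeNS, arXiv:2107.06509]
#3 NoTraceConcentration (crux) — TerminalTrace crux B stmt-NavierStokesRegularity-18381 verbatim: in
the frame (classical on [0,T), Leray–Hopf, rapidly decaying datum) the final value has no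
scaled-energy concentration at any point: r⁻¹∫_(B(x₀,r))|u(T,x)|²dx → 0 as r ↓ 0, for every x₀.
[difficulty: open-problem] (why it might fail: a-priori claim at the critical scaling at a fixed
time, beyond every energy-class bound; a Type-I-like |x−x₀|⁻¹ scar has constant density 4πc² (so it
fails on any self-similar-profile blow-up; Hou2022 numerics), and Tao's averaged cascade leaves
infinite density.) [SereginSverak2002, BarkerPrange2021, Tao2016AveragedNS,
Hou2022PotentiallySingularNS, arXiv:1705.04420, CKN1982]
#9 BudgetedExtinctApex (support) — in the frame, given the quarter-law bound with constant K, an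
energy-flat terminal trace at x₀ (FE(x₀)) and the ε-regularity singular clause at (T,x₀) (u
essentially unbounded on every parabolic cylinder Q_r(T,x₀), r²<T), there is a BUDGETED extinct
Type-I apex: U,P,G and class constants M,D₀ : ℝ≥0, C,K′ : ℝ with the six-clause apex package of
`typeITraceScarL3_of_loud` verbatim (suitable weak in every Q_a(0,0); weak spatial gradient G;
typeIBound ≤ M on every Q_a; cknD ≤ D₀ below t=0; sup rate ‖U(s)‖ ≤ C/√(−s); weak nullity of U(s) as
s ↑ 0) AND the slab enstrophy budget ∫⁻_((−r²,0)×ℝ³) ‖G‖ₑ² ≤ K′r for every r>0 AND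
IsBackwardSingularPoint U 0. Proof plan (provable-now, M–L): `exists_extinctApex_zoomData_unit`
(Theorems/TerminalTraceTypeITraceScarL3ExtinctApexZoomData) with its L³-trace input replaced by FE
through `ae_abs_pairing_le_near_top_of_morrey`, IsTypeIBlowup from
`lerayQuarterDissipation_recordTimeTypeI_proof` (RecordTimeTypeI, proved), viscosity normalisation
and the cknD clause as in `stub_extinctApexD_of_L3trace`, singular clause via
`not_isBackwardBoundedAt_of_forall_eLpNorm_top`; the one new step is inheritance of the budget:
∫_(T−ρ²)^T ‖∇u‖₂² = ∫‖curl u‖₂² ≤ 2Kρ is invariant under the NS zoom and weakly lower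
semicontinuous, and the weak L² limit of the zoomed gradients is G a.e. (uniqueness of weak
gradients). [difficulty: provable-now] [AlbrittonBarker2019, SereginSverak2002,
EscauriazaSereginSverak2003, CKN1982, WangZhang2012]
#9 NoBudgetedExtinctApex (support) — no budgeted extinct Type-I apex is singular at its apex: the
six-clause package plus the slab budget ∫⁻_((−r²,0)×ℝ³) ‖G‖ₑ² ≤ K′r (all r>0) give ¬
IsBackwardSingularPoint U 0. Proof plan (provable-now, M): PACKING — if 0 is apex-singular, the
apex-time singular set Σ₀ is perfect and uncountable
(`not_countable_topSingularSet_of_quietShellExclusion` with hQA := `no_quietShellExtinctApex`, both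
landed); but for N points of Σ₀ pairwise 2√T₁-separated, the class-uniform depth floor
`stub_centreEnstrophyAtDepth` (landed p593596; translates via `apexPackage_translate`,
`isBackwardSingularPoint_translate_zero_iff`; strip representative
`exists_strip_representative_of_apex`) yields on a window of length c₂T₁ inside (−2T₁,−T₁/4) the
floor ∫_(B(x_i,√T₁))|curl V|² ≥ κ₀T₁^(−1/2); integrating and summing over the disjoint balls against
the budget (|curl V|² ≤ 2‖G‖² a.e.) gives N·κ₀c₂√T₁ ≤ 2K′√2·√T₁, so card Σ₀ ≤ N*(K′,κ₀,c₂) — finite,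
contradiction. Alternative plan: ESS far field — the budget puts U(s) ∈ Ḣ¹ ⊂ L⁶(ℝ³) for a.e. s,
ε-regularity far out gives exterior smoothness, extinction + backward uniqueness + unique
continuation (`ess_unique_continuation`) force U ≡ 0 near the apex. [difficulty: provable-now]
[WangZhang2012, Seregin2001, ChoeWolfYang2019, Barker2021, EscauriazaSereginSverak2003,
Tao2021QuantitativeNS] S1 PROVER NOTE (price P4): the slab budget must be taken as the limit of the
scaled family at FIXED r with λ ≤ λ₀(r) (pre-zoom the inequality only holds for r² < T; after the
zoom every r is covered), by weak lower semicontinuity — not from a single pre-zoom inequality.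
STAFFING (price P2): one prover, S2 FIRST (deliver the finite bound N* ≤ 2√2K′/(κ₀c₂) as a NAMED
lemma «LOUD ∩ BUDGET = ∅» that TerminalTrace can import), then S1 (reuse the proof skeleton of
exists_extinctApex_zoomData_unit, do not fork it).

TWO-LAYER PLAN. BudgetedExtinctApex ⇐ ZoomBudgetInheritance (the slab budget passes to the weak
gradient G of the Albritton–Barker/Seregin–Šverák zoom limit) → ExtinctApexOfFE (=
`exists_extinctApex_zoomData_unit` with FE in place of the L³ trace) → BudgetedExtinctApex.
NoBudgetedExtinctApex ⇐ FiniteTopDustOfBudget (card Σ₀ ≤ N*(K′,M,D₀,C) by packing the depth floor) →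
(landed) uncountable top dust → NoBudgetedExtinctApex. Nothing filed now.

KILL CRITERIA. Refutation of EnstrophyQuarterLaw (a finite-energy blow-up with a Type-II enstrophy
burst, e.g. a rigorous Hou-type singularity) closes the route `refuted:EnstrophyQuarterLaw` together
with the whole eI shelf; refutation of NoTraceConcentration (a blow-up with a terminal energy scar)
closes it `refuted:NoTraceConcentration` and retargets the budget lever to TerminalTrace's scar side
(TypeITraceScarL3 18385: LOUD ∩ BUDGET = ∅ survives as a supports-theorem). A refutation of either
SUPPORT as typed (e.g. the weak-gradient budget not inherited because G is not the distributional
limit) forces a restatement of the package, not a pivot. NoLocalTypeISingularity (10480) proved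
elsewhere moots the line (then SWB closes the shelf directly).

NOT DECOMPOSED YET. The constants (κ₀, c₂ of the depth floor; the packing number N*), the
weak-gradient identification inside the zoom, the curl-vs-gradient pointwise bound for the strip
representative, and the viscosity normalisation are layer-2 children of the two supports; the cruxes
X1, X2 are shared items with their own programmes (1574: skeleton of record Lines/sparse_sieve.lean
+ Lines/window_average.lean; 18381: TerminalTrace) and are not re-decomposed here.

CHEAPEST FALSIFIER. Exhibit ONE budgeted singular extinct apex in class H: a local suitable Type-I
ancient flow on ℝ³×(−∞,0) with ‖U(s)‖_∞ ≤ C/√(−s), weakly null at s=0, singular at the origin, and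
∫_(−r²)^0∫‖∇U‖² ≤ K′r for all r — it refutes NoBudgetedExtinctApex outright. Run first: the packing
arithmetic against the landed floor (N·κ₀c₂ ≤ 2√2K′ must bound N uniformly in T₁ — checked by hand:
both sides scale like √T₁, so N* is scale-free); and the backward-DSS toy (BC5 rung): a λ-DSS field
with bounded enstrophy on one period obeys the slice law Z(t) ≤ λB/√(−t) (proved in
rung/EnstrophySliceDss.lean), so DSS blow-ups cannot kill X1 by rate alone — only by infinite
one-period enstrophy.

NUMBERS. Leray's lower bound ‖∇u(t)‖₂ ≥ c ν^(3/4)(T−t)^(−1/4) (Leray1934;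
RobinsonRodrigoSadowski2016 Thm 8.x) makes X1 the statement that Leray's rate is attained up to a
constant; weak Serrin pair of X1: (p,q)=(6,4) with 3/p+2/q=1 (WangZhang2012 Thm 5.3: finitely many
singular points for 3<p<∞; Barker2021: O(M^20) points under sup_t‖u‖_(L^(3,∞)) ≤ M); QUIET/LOUD
threshold of the apex class: β*(A₀)=½−log2/(2·log(8A₀)) (nsreg-p2 ROUND-26).

DEFINITION REQUESTS. None: every notion is an existing declaration (IsSuitableWeakSolutionInBall,
HasWeakSpatialGradientOn, typeIBound, cknD, IsBackwardSingularPoint, parabolicCylinder(Opens), curl,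
IsMaximalSmoothSolution, IsLerayHopfOn, HasRapidSpatialDecay).

Novelty: Searches (2026-08-28): lit search --hybrid "Type I blow-up finitely many singular points
Navier-Stokes first singular time enstrophy" (10 docs: Seregin2014 notes pp.130–174, RRS2016
pp.337–341, Lemarié-Rieusset2016 p.771 — none joins an enstrophy rate to the terminal trace); lit
vsearch "set of singular points at the blow-up time is finite; concentration of L3 norm or enstrophy
near each singular point; Type I" (12 docs, same books); lit search --source all "Navier-Stokes
number of singular points weak L3 first blow-up time" (local: arxiv-1201.1100 WangZhang2012 Thm 5.3,
arxiv-2111.14776 Barker2021, choe2019 CWY, arxiv-2003.06717 Barker–Prange quantitative,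
arxiv-2510.20757; crossref: Seregin2001 doi:10.1002/cpa.3002); lit galaxy search "number of singular
points|finitely many singular points" --star all (24 rows, 0 relevant); lean search / tree: Theses
of the sub (no route couples 1574 with 18381/18385; TerminalTrace header "no Type-I/Type-II split is
filed anywhere").
Nearest prior art found: WangZhang2012 (arXiv:1201.1100) Thm 5.3 — finitely many singular points at
each time in the weak Serrin class L^(q,∞)_t L^p_x (3<p<∞), which contains every solution obeying X1
(p=6); they state regularity in that class is unknown (p.3). In the tree: nsreg-p2's class-H
programme on stmt-18385 (Q1 depth floor, quiet-shell exclusion, uncountable LOUD dust) — rate-free,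
no budget.
Delta: the line transplants the summable-class count into the extinct Type-I apex class, where the
landed quie  [refs: 10.1002/cpa.3002, 1201.1100, arxiv-1201.1100, arxiv-2111.14776, arxiv-2003.06717, arxiv-2510.20757, doi:10.1002/cpa.3002, Seregin2014, WangZhang2012, Barker2021, Seregin2001]

Barriers (technique_class: blowup-rescaling, epsilon-regularity, packing, carleman): - technique_class: blowup-rescaling, epsilon-regularity, packing, carleman
- Literature.Barriers.NavierStokesRegularity.EnergySupercriticality: X1 and X2 are a-priori
critical-scaling claims and sit inside the class the heuristic warns about; the route does not claim
to prove them by energy methods — they are shared wuc residuals (consequences of S used toward S);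
the supports work on the zoom limit where the budget is scale-invariant, not supercritical.
- Literature.Barriers.NavierStokesRegularity.TaoAveragedBlowup: the supports use NS-specific
structure unavailable to averaged equations — the vorticity equation and Biot–Savart behind the
depth enstrophy floor (strip representative) and Carleman unique continuation for the true equation
behind quiet-shell exclusion; X2 is false for Tao's cascade (infinite terminal density), so the line
is not an abstract energy-plus-estimates argument.
- Literature.Barriers.NavierStokesRegularity.AveragedTypeIBlowup: a Type-I blow-up exists for an
averaged NS with energy identity, so Type-I exclusion must use the true nonlinearity:
NoBudgetedExtinctApex does (vorticity floor + Carleman), and it excludes only BUDGETED EXTINCT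
apices, not Type I at large.
- Literature.Barriers.NavierStokesRegularity.NSITypeIIBlowup: «suitability is rate-blind» kills rate
conclusions drawn from local-energy axiomatics; here the rate X1 is a HYPOTHESIS (crux), never
concluded, and the companion `not_nsi_typeI_exclusion_viscosity` (no NSI-valid Type-I criterion)

sub-problem: NavierStokesRegularity · status: open · opened planner-ns-idea-9-g2-0 2026-08-28T06:09:03Z · rev 1 · ledger route-NavierStokesRegularity-QuarterBudgetTrace
GENERATED by the gate from the ledger (D-0016/17). Provers cite these decls: `theorem foo : Summit.NavierStokesRegularity.NavierStokesRegularity.Theses.QuarterBudgetTrace.<Decl> := …` in Summits/NavierStokesRegularity/NavierStokesRegularity/Theorems/<Name>.lean.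
-/

namespace Summit.NavierStokesRegularity.NavierStokesRegularity.Theses.QuarterBudgetTrace

open scoped BigOperators Topology Manifold Classical MeasureTheory ProbabilityTheory Matrix InnerProductSpace ComplexConjugate ContinuousMap
open Filter Set Function TopologicalSpace MeasureTheory

attribute [summit_statement] _root_.NavierStokesRegularity

open Literature.NS

/-- item stmt-NavierStokesRegularity-1574 · crux · rank 2 · open · by planner
why it might fail: says every finite-energy blow-up is Type I in enstrophy (Leray's lower rate is sharp); no upper bound on any NS blow-up rate is known, and with Seregin2020 (axisymmetric singular points are Type II) one singular axisymmetric flow (Hou2022 numerics) kills it.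
sources: Leray1934, Seregin2020, Hou2022PotentiallySingularNS, Tao2021QuantitativeNS, arXiv:2107.06509
[crux] QUARTER LAW / enstrophy at Leray's rate (card F6; absorbs leray-quanta-energy-modulus X_H).
If a finite-energy classical solution from a rapidly decaying datum is maximal at T<oo, then
Omega(t) = int |curl u(t)|^2 <= K (T-t)^{-1/2} on [0,T) for some K (lintegral form: infinite
enstrophy violates it). Leray1934 sec.19-22 gives the matching LOWER bound Omega >= c
nu^{3/2}(T-t)^{-1/2} (in tree: leray_blowup_rate_top family), so the claim is 'dissipation blows up
at exactly Leray's rate'. Spectral form (the card's thesis object): with alpha = xi.(grad u)xi and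
Lambda(t) = sup_psi (int alpha_+|psi|^2 - nu int|grad psi|^2)/int|psi|^2 = sup spec(nu Lap +
alpha_+), one has d/dt log Omega <= 2 Lambda, blow-up forces int_{t0}^t Lambda >= (1/4) log(1/(T-t))
- C, and the crux is equivalent to int_{t0}^t (Lambda_eff - 1/(4(T-s))) ds = O(1) with Lambda_eff :=
(1/2) d/dt log Omega <= Lambda: 'Type II <=> the stretching well binds more than a quarter per unit
log-time'. Consequences (not filed): E(Q(z,r)) = r^{-1} intint_Q |grad u|^2 <= 2K/nu-scaled for
EVERY parabolic ball below T (uniform rescaled-energy Type I => TypeIBridge); expected, to be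
checked (leray-quanta graft): finitely many s -/
@[route_item "route-NavierStokesRegularity-QuarterBudgetTrace", crux]
def EnstrophyQuarterLaw : Prop :=
  ∀ (ν T : ℝ), 0 < ν → 0 < T → ∀ (u : ℝ → EuclideanSpace ℝ (Fin 3) → EuclideanSpace ℝ (Fin 3)) (p : ℝ → EuclideanSpace ℝ (Fin 3) → ℝ), Literature.Analysis.FluidPDE.IsMaximalSmoothSolution ν 0 u p T → Literature.Analysis.FluidPDE.IsLerayHopfOn T ν 0 (u 0) u → Literature.Analysis.FluidPDE.HasRapidSpatialDecay (u 0) → ∃ K : ℝ, ∀ t ∈ Set.Ico 0 T, ∫⁻ x, ‖Literature.Analysis.FluidPDE.curl (u t) x‖ₑ ^ 2 ≤ ENNReal.ofReal (K / Real.sqrt (T - t))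

/-- item stmt-NavierStokesRegularity-18381 · crux · rank 3 · open · by planner
why it might fail: a-priori claim at the critical scaling at a fixed time, beyond every energy-class bound; a Type-I-like |x−x₀|⁻¹ scar has constant density 4πc² (so it fails on any self-similar-profile blow-up; Hou2022 numerics), and Tao's averaged cascade leaves infinite density.
sources: SereginSverak2002, BarkerPrange2021, Tao2016AveragedNS, Hou2022PotentiallySingularNS, arXiv:1705.04420, CKN1982
[crux] (2001 step 5, FE grade; a priori) in the frame, the final value u T has no scaled-energy
concentration at ANY point: r⁻¹∫_{B(x₀,r)}|u(T,x)|²dx → 0 for every x₀. Known at backward-bounded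
points (tree), hence the content is at the 𝒫¹-null singular set Σ_T; a Type-I-like |x−x₀|⁻¹ scar has
constant density 4πc² and a β<1/2-tailed collapse infinite density, so the crux says: a first-time
singularity, if any, is residue-free in energy density. [difficulty: open-problem] -/
@[route_item "route-NavierStokesRegularity-QuarterBudgetTrace", crux]
def NoTraceConcentration : Prop :=
  ∀ (ν T : ℝ), 0 < ν → 0 < T → ∀ (u : ℝ → EuclideanSpace ℝ (Fin 3) → EuclideanSpace ℝ (Fin 3)) (p : ℝ → EuclideanSpace ℝ (Fin 3) → ℝ), Literature.Analysis.FluidPDE.IsClassicalNSSolutionOn (Set.Ico 0 T) ν 0 u p → Literature.Analysis.FluidPDE.IsLerayHopfOn T ν 0 (u 0) u → Literature.Analysis.FluidPDE.HasRapidSpatialDecay (u 0) → ∀ x₀ : EuclideanSpace ℝ (Fin 3), Filter.Tendsto (fun r : ℝ => r⁻¹ * ∫ x in Metric.ball x₀ r, ‖u T x‖ ^ 2) (nhdsWithin 0 (Set.Ioi 0)) (nhds 0)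

/-- item stmt-NavierStokesRegularity-26014 · support · rank 9 · closed · proved by Summit.NavierStokesRegularity.NavierStokesRegularity.Theorems.QuarterBudgetTraceBudgetedExtinctApex.budgetedExtinctApex (prover) · by planner
sources: AlbrittonBarker2019, SereginSverak2002, EscauriazaSereginSverak2003, CKN1982, WangZhang2012
[support] in the frame, given the quarter-law bound with constant K, an energy-flat terminal trace
at x₀ (FE(x₀)) and the ε-regularity singular clause at (T,x₀) (u essentially unbounded on every
parabolic cylinder Q_r(T,x₀), r²<T), there is a BUDGETED extinct Type-I apex: U,P,G and class
constants M,D₀ : ℝ≥0, C,K′ : ℝ with the six-clause apex package of `typeITraceScarL3_of_loud`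
verbatim (suitable weak in every Q_a(0,0); weak spatial gradient G; typeIBound ≤ M on every Q_a;
cknD ≤ D₀ below t=0; sup rate ‖U(s)‖ ≤ C/√(−s); weak nullity of U(s) as s ↑ 0) AND the slab
enstrophy budget ∫⁻_((−r²,0)×ℝ³) ‖G‖ₑ² ≤ K′r for every r>0 AND IsBackwardSingularPoint U 0. Proof
plan (provable-now, M–L): `exists_extinctApex_zoomData_unit`
(Theorems/TerminalTraceTypeITraceScarL3ExtinctApexZoomData) with its L³-trace input replaced by FE
through `ae_abs_pairing_le_near_top_of_morrey`, IsTypeIBlowup from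
`lerayQuarterDissipation_recordTimeTypeI_proof` (RecordTimeTypeI, proved), viscosity normalisation
and the cknD clause as in `stub_extinctApexD_of_L3trace`, singular clause via
`not_isBackwardBoundedAt_of_forall_eLpNorm_top`; the one new step is inheritance of the budget:
∫_(T−ρ²)^T ‖∇u‖₂² = ∫‖curl u‖₂ -/
@[route_item "route-NavierStokesRegularity-QuarterBudgetTrace", crux]
def BudgetedExtinctApex : Prop :=
  ∀ (ν T : ℝ), 0 < ν → 0 < T → ∀ (u : ℝ → EuclideanSpace ℝ (Fin 3) → EuclideanSpace ℝ (Fin 3)) (p : ℝ → EuclideanSpace ℝ (Fin 3) → ℝ), Literature.Analysis.FluidPDE.IsClassicalNSSolutionOn (Set.Ico 0 T) ν 0 u p → Literature.Analysis.FluidPDE.IsLerayHopfOn T ν 0 (u 0) u → Literature.Analysis.FluidPDE.HasRapidSpatialDecay (u 0) → ∀ K : ℝ, (∀ t ∈ Set.Ico 0 T, ∫⁻ x, ‖Literature.Analysis.FluidPDE.curl (u t) x‖ₑ ^ 2 ≤ ENNReal.ofReal (K / Real.sqrt (T - t))) → ∀ x₀ : EuclideanSpace ℝ (Fin 3), Filter.Tendsto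 (fun r : ℝ => r⁻¹ * ∫ x in Metric.ball x₀ r, ‖u T x‖ ^ 2) (nhdsWithin 0 (Set.Ioi 0)) (nhds 0) → (∀ r : ℝ, 0 < r → r ^ 2 < T → MeasureTheory.eLpNorm (Function.uncurry u) ⊤ (MeasureTheory.volume.restrict (Literature.Analysis.FluidPDE.parabolicCylinder r ((T : ℝ), x₀))) = ⊤) → ∃ (U : ℝ → EuclideanSpace ℝ (Fin 3) → EuclideanSpace ℝ (Fin 3)) (P : ℝ → EuclideanSpace ℝ (Fin 3) → ℝ) (G : ℝ → EuclideanSpace ℝ (Fin 3) → EuclideanSpace ℝ (Fin 3) →L[ℝ] EuclideanSpace ℝ (Fin 3)) (M D₀ : NNReal) (C K' : ℝ), (∀ a : ℝ, 0 < a → Literature.Analysis.FluidPDE.IsSuitableWeakSolutionInBall a (0 : ℝ × EuclideanSpace ℝ (Fin 3)) U P) ∧ (∀ a : ℝ, 0 < a → Literature.Analysis.FluidPDE.HasWeakSpatialGradientOn (Literature.Analysis.FluidPDE.parabolicCylinderOpens a (0 : ℝ × EuclideanSpace ℝ (Fin 3))) U G) ∧ (∀ a : ℝ, 0 < a → Literature.Analysis.FluidPDE.typeIBound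 (Literature.Analysis.FluidPDE.parabolicCylinder a (0 : ℝ × EuclideanSpace ℝ (Fin 3))) U P G ≤ M) ∧ (∀ z₀ : ℝ × EuclideanSpace ℝ (Fin 3), z₀.1 ≤ 0 → ∀ r : ℝ, 0 < r → Literature.Analysis.FluidPDE.cknD r z₀ P ≤ D₀) ∧ (∀ s : ℝ, s < 0 → ∀ᵐ y : EuclideanSpace ℝ (Fin 3), ‖U s y‖ ≤ C / Real.sqrt (-s)) ∧ (∀ φ : EuclideanSpace ℝ (Fin 3) → EuclideanSpace ℝ (Fin 3), ContDiff ℝ (⊤ : ℕ∞) φ → HasCompactSupport φ → ∀ ε : ℝ, 0 < ε → ∃ s₀ : ℝ, s₀ < 0 ∧ ∀ᵐ s ∂(MeasureTheory.volume.restrict (Set.Ioo s₀ 0)), |∫ y, ⟪U s y, φ y⟫_ℝ| ≤ ε) ∧ (∀ r : ℝ, 0 < r → ∫⁻ z in Set.Ioo (-(r ^ 2)) 0 ×ˢ (Set.univ : Set (EuclideanSpace ℝ (Fin 3))), ‖G z.1 z.2‖ₑ ^ 2 ≤ ENNReal.ofReal (K' * r)) ∧ Literature.Analysis.FluidPDE.IsBackwardSingularPoint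 U (0 : ℝ × EuclideanSpace ℝ (Fin 3))

-- `BudgetedExtinctApex` holds: proved by `Summit.NavierStokesRegularity.NavierStokesRegularity.Theorems.QuarterBudgetTraceBudgetedExtinctApex.budgetedExtinctApex` (its module imports this route file, so no `_holds` link can be stated here).

/-- item stmt-NavierStokesRegularity-26015 · support · rank 9 · closed · proved by Summit.NavierStokesRegularity.NavierStokesRegularity.Theorems.QuarterBudgetTraceNoBudgetedExtinctApex.noBudgetedExtinctApex (prover) · by planner
sources: WangZhang2012, Seregin2001, ChoeWolfYang2019, Barker2021, EscauriazaSereginSverak2003, Tao2021QuantitativeNS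
[support] no budgeted extinct Type-I apex is singular at its apex: the six-clause package plus the
slab budget ∫⁻_((−r²,0)×ℝ³) ‖G‖ₑ² ≤ K′r (all r>0) give ¬ IsBackwardSingularPoint U 0. Proof plan
(provable-now, M): PACKING — if 0 is apex-singular, the apex-time singular set Σ₀ is perfect and
uncountable (`not_countable_topSingularSet_of_quietShellExclusion` with hQA :=
`no_quietShellExtinctApex`, both landed); but for N points of Σ₀ pairwise 2√T₁-separated, the
class-uniform depth floor `stub_centreEnstrophyAtDepth` (landed p593596; translates via
`apexPackage_translate`, `isBackwardSingularPoint_translate_zero_iff`; strip representative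
`exists_strip_representative_of_apex`) yields on a window of length c₂T₁ inside (−2T₁,−T₁/4) the
floor ∫_(B(x_i,√T₁))|curl V|² ≥ κ₀T₁^(−1/2); integrating and summing over the disjoint balls against
the budget (|curl V|² ≤ 2‖G‖² a.e.) gives N·κ₀c₂√T₁ ≤ 2K′√2·√T₁, so card Σ₀ ≤ N*(K′,κ₀,c₂) — finite,
contradiction. Alternative plan: ESS far field — the budget puts U(s) ∈ Ḣ¹ ⊂ L⁶(ℝ³) for a.e. s,
ε-regularity far out gives exterior smoothness, extinction + backward uniqueness + unique
continuation (`ess_unique_continuation`) force U ≡ 0 near the apex. [ -/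
@[route_item "route-NavierStokesRegularity-QuarterBudgetTrace", crux]
def NoBudgetedExtinctApex : Prop :=
  ∀ (M D₀ : NNReal) (C K' : ℝ) (U : ℝ → EuclideanSpace ℝ (Fin 3) → EuclideanSpace ℝ (Fin 3)) (P : ℝ → EuclideanSpace ℝ (Fin 3) → ℝ) (G : ℝ → EuclideanSpace ℝ (Fin 3) → EuclideanSpace ℝ (Fin 3) →L[ℝ] EuclideanSpace ℝ (Fin 3)), (∀ a : ℝ, 0 < a → Literature.Analysis.FluidPDE.IsSuitableWeakSolutionInBall a (0 : ℝ × EuclideanSpace ℝ (Fin 3)) U P) → (∀ a : ℝ, 0 < a → Literature.Analysis.FluidPDE.HasWeakSpatialGradientOn (Literature.Analysis.FluidPDE.parabolicCylinderOpens a (0 : ℝ × EuclideanSpace ℝ (Fin 3))) U G) → (∀ a : ℝ, 0 < a → Literature.Analysis.FluidPDE.typeIBound (Literature.Analysis.FluidPDE.parabolicCylinder a (0 : ℝ × EuclideanSpace ℝ (Fin 3))) U P G ≤ M) → (∀ z₀ : ℝ × EuclideanSpace ℝ (Fin 3), z₀.1 ≤ 0 → ∀ r : ℝ, 0 < r → Literature.Analysis.FluidPDE.cknD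 r z₀ P ≤ D₀) → (∀ s : ℝ, s < 0 → ∀ᵐ y : EuclideanSpace ℝ (Fin 3), ‖U s y‖ ≤ C / Real.sqrt (-s)) → (∀ φ : EuclideanSpace ℝ (Fin 3) → EuclideanSpace ℝ (Fin 3), ContDiff ℝ (⊤ : ℕ∞) φ → HasCompactSupport φ → ∀ ε : ℝ, 0 < ε → ∃ s₀ : ℝ, s₀ < 0 ∧ ∀ᵐ s ∂(MeasureTheory.volume.restrict (Set.Ioo s₀ 0)), |∫ y, ⟪U s y, φ y⟫_ℝ| ≤ ε) → (∀ r : ℝ, 0 < r → ∫⁻ z in Set.Ioo (-(r ^ 2)) 0 ×ˢ (Set.univ : Set (EuclideanSpace ℝ (Fin 3))), ‖G z.1 z.2‖ₑ ^ 2 ≤ ENNReal.ofReal (K' * r)) → ¬ Literature.Analysis.FluidPDE.IsBackwardSingularPoint U (0 : ℝ × EuclideanSpace ℝ (Fin 3))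

-- `NoBudgetedExtinctApex` holds: proved by `Summit.NavierStokesRegularity.NavierStokesRegularity.Theorems.QuarterBudgetTraceNoBudgetedExtinctApex.noBudgetedExtinctApex` (its module imports this route file, so no `_holds` link can be stated here).

/-- item stmt-NavierStokesRegularity-26016 · assembly · rank 1 · open · by planner
sources: Fefferman2000, CKN1982, AlbrittonBarker2019
[assembly] EnstrophyQuarterLaw → NoTraceConcentration → BudgetedExtinctApex → NoBudgetedExtinctApex
→ Clay (A). -/
@[route_item "route-NavierStokesRegularity-QuarterBudgetTrace"]
def Assembly : Prop :=
  EnstrophyQuarterLaw → NoTraceConcentration → BudgetedExtinctApex → NoBudgetedExtinctApex → NavierStokesRegularity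

/-! D-0027 §2.1 — DECIDING THEOREM (planner-authored via `route open/edit --closes-file`; by planner-ns-idea-9-g2-0 2026-08-28T06:09:03Z):
its hypotheses are this route's items and its conclusion the sub-problem Statement (glue_lint), and it elaborates with this file. -/

/-- The deciding theorem (D-0027 §2.1): the two cruxes (quarter law, energy-flat terminal trace) and the
two provable-now supports (budgeted extinct apex; no budgeted extinct apex) decide Clay (A). Pure logic over
the frame theorem `navierStokesRegularity_of_noBlowup` and the ε-regularity contrapositive
`exists_singularPoint_of_classical_of_not_hasSmoothExtensionPast`. -/
@[closes "route-NavierStokesRegularity-QuarterBudgetTrace"] theorem closes (hQ : EnstrophyQuarterLaw) (hN : NoTraceConcentration) (hA : BudgetedExtinctApex)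
    (hX : NoBudgetedExtinctApex) : NavierStokesRegularity := by
  refine Summit.NavierStokesRegularity.NavierStokesRegularity.Theorems.navierStokesRegularity_of_noBlowup ?_
  intro ν T hν hT u p hcl hLH hdec
  by_contra hext
  obtain ⟨K, hK⟩ := hQ ν T hν hT u p ⟨hcl, hext⟩ hLH hdec
  obtain ⟨x₀, hx₀⟩ :=
    Literature.Analysis.FluidPDE.exists_singularPoint_of_classical_of_not_hasSmoothExtensionPast
      hν hT hcl hLH hdec hext
  have hFE := hN ν T hν hT u p hcl hLH hdec x₀
  obtain ⟨U, P, G, M, D₀, C, K', hsw, hG, hI, hD, hrate, htop, hbud, hsing⟩ :=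
    hA ν T hν hT u p hcl hLH hdec K hK x₀ hFE hx₀
  exact hX M D₀ C K' U P G hsw hG hI hD hrate htop hbud hsing

end Summit.NavierStokesRegularity.NavierStokesRegularity.Theses.QuarterBudgetTrace
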